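import Mathlib
import Literature.NumberTheory.LFunctions.Zhang2022.TypedSection08B
import Literature.NumberTheory.LFunctions.Zhang2022.Section8Lemma84Contour
import Literature.NumberTheory.LFunctions.Zhang2022.Section8Lemma82Steps
import Literature.NumberTheory.LFunctions.Zhang2022.Section8PerronSteps
import Literature.NumberTheory.LFunctions.KhaleLemma41
import Literature.NumberTheory.LFunctions.MontgomeryVaughan2001PrimeSums
import Literature.Analysis.Complex.RectangleResiduePolarParts
import HarnessLib

/-!
# Zhang (2022) §8, proof of Lemma 8.2: `Z22:§8.u030` (first equality) DISCHARGED — the contour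
# shift `Σ_{m<x} χ(m)m^{−(1−β_j)}(x/m)^{β_μ}log(x/m) = (1/2πi)∮_{|s|=5α} L(1−β_j+s,χ)x^s(s−β_μ)⁻² ds + O(ε₁)`

Topic `Literature/NumberTheory/LFunctions/Zhang2022` (Landau–Siegel adjudication tree;
verdict-neutral). Y. Zhang, *Discrete mean estimates and the Landau–Siegel zero*,
arXiv:2211.02515v1 (2022) [Zhang2022LandauSiegel] — **an unrefereed manuscript under adjudication**
— §8, proof of Lemma 8.2 (PDF p.45, tex L2349–L2366): "The sum is equal to
`(1/2πi)∫_{(1)} L(1−β_j+s,χ)x^s ds/(s−β_μ)²`. We move the contour of integration to the vertical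
segments `s = α+it` (`|t| ≥ D`), `s = −𝓛⁻¹+it` (`|t| ≤ D`) and to the two connecting horizontal
segments. It follows by Lemma 5.6 that `Σ_{m<x} … = (1/2πi)∫_{|s|=5α} L(1−β_j+s,χ)x^s ds/(s−β_μ)² + O(ε₁)`."

D-0069 campaign (cell `siegel-zhang`), discharge prover sz-d18, RE-POINT of sz-L2-lead (LEDGER #10,
R29): the typed node `Typed.S8B.Sum82ViaCircle c′` (L2-t6, `TypedSection08B`) is PROVED
(`sum82ViaCircle_holds`), for every `c′`, with `c = 1` and an absolute `C`. (`Z22:§8.u028`, `u029`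
are the contour OBJECTS `contour82V`, `contour82H` — no claim; the second equality of `§8.u030` and
its passage to Lemma 8.2 are the tree's `Section8Lemma82Steps.circle82_sub_le`,
`sum82CircleMainTerm_of_viaCircle` and `Typed.S8B.lemma82_of_circleMainTerm`.)

Route (kernel; 0 new facts). In the variable `u = s − β_μ` the integrand is
`x^{β_μ}·e^{u log x}Φ(u)/u²`, `Φ(u) = L(1−β_j+β_μ+u,χ)` entire (`χ ≠ 1`):
(1) Perron for the logarithmic Riesz mean and the pole-free shift to `Re u = α` in one step —
the tree's `Zhang2022.Lemma84.sum_log_eq_integral_shift` (built for the twin step (8.9) of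
Lemma 8.4), with `|L(w,χ)| ≤ ζ(Re w) ≤ 1 + 1/α` on `Re w ≥ 1+α` (`KhaleL41.norm_LFunction_le_re_riemannZeta`,
`MontgomeryVaughan2001.norm_zeta_real_le`);
(2) the line `Re u = α` is decomposed at height `T′ = D³` against the rectangle
`[−1/2, α] × [−T′, T′]` (`Lemma84.integral_line_decomp`), whose boundary integral is `2πi·φ′(0)`,
`φ(u) = e^{u log x}Φ(u)` (double pole at `u = 0`; the tree's residue theorem
`Literature.Analysis.Complex.rectBoundaryIntegral_eq_sum_of_poles_iteratedDeriv`), while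
`(1/2πi)∮_{|s|=5α} L(1−β_j+s,χ)x^s(s−β_μ)⁻² ds = x^{β_μ}φ′(0)` (Cauchy's formula for the derivative,
Mathlib; `|β_μ| ≤ 5α/2`);
(3) the pieces: tails `≪ e^{α log x}(1+α⁻¹)/T′ ≤ e^π𝓛⁹/D³`, left side `≪ x^{−1/2}·D·T′`
(crude bound `|L(w,χ)| ≤ D|w|ζ(5/4)` on `Re w ≥ 1/4`, `DirichletZFR.norm_LFunction_le_of_re_ge`;
`x > T = e^{𝓛^{1.1}}`), horizontal sides `≪ D·T′/T′²` — all `≤ C e^{−𝓛} ≤ C e^{−𝓛^{1/10}}` once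
`𝓛^{1/10} ≥ 10`. The kernel contour is the rectangle with left side `Re s = −1/2` and height `D³`
rather than the printed `Re s = −𝓛⁻¹`, `|t| = D` — immaterial to the typed claim, which fixes only
the circle `|s| = 5α` and the error `O(ε₁)`, `ε₁ = exp(−c𝓛^{1/10})`; the printed attribution
"by Lemma 5.6" (a prime-sum estimate) is not what is consumed (recorded, not judged).
WHAT THIS FILE IS NOT: any claim about the manuscript's Theorems 1–2 or about Landau–Siegel zeros.

## References

* Y. Zhang, arXiv:2211.02515v1 (2022), §8 proof of Lemma 8.2, p.45. [cite: Zhang2022LandauSiegel, §8 Lemma 8.2 p.45]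
* H. L. Montgomery, R. C. Vaughan, *Multiplicative Number Theory I*, CUP 2007, §5.1, §6.2.
  [cite: MontgomeryVaughan2007, §6.2]
-/

noncomputable section

open Complex Real Set MeasureTheory Filter Topology intervalIntegral

namespace Literature.NumberTheory.LFunctions.Zhang2022.Section8Sum82ViaCircle

open Literature.NumberTheory.LFunctions.Zhang2022.Skeleton
open Literature.NumberTheory.LFunctions Literature.Analysis.Complex

/-! ### Parameter facts -/

/-- `‖x^β‖ = 1` for real `x > 0` and purely imaginary `β`. [folklore] -/
private theorem norm_cpow_of_re_eq_zero {x : ℝ} (hx : 0 < x) {β : ℂ} (hβ : β.re = 0) :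
    ‖(x : ℂ) ^ β‖ = 1 := by
  rw [Complex.norm_cpow_eq_rpow_re_of_pos hx, hβ, Real.rpow_zero]

/-- `x^u = exp(u·log x)` for real `x > 0`. [folklore] -/
private theorem cpow_eq_exp {x : ℝ} (hx : 0 < x) (u : ℂ) :
    (x : ℂ) ^ u = cexp (u * (Real.log x : ℂ)) := by
  rw [Complex.cpow_def_of_ne_zero (by exact_mod_cast hx.ne'), ← Complex.ofReal_log hx.le, mul_comm]

/-- `(x/m)^β = x^β · m^{−β}` for reals `x, m > 0`. [folklore] -/
private theorem div_cpow_eq {x m : ℝ} (hx : 0 < x) (hm : 0 < m) (β : ℂ) :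
    ((x / m : ℝ) : ℂ) ^ β = (x : ℂ) ^ β * (m : ℂ) ^ (-β) := by
  rw [cpow_eq_exp (div_pos hx hm), cpow_eq_exp hx, Complex.cpow_neg, cpow_eq_exp hm,
    ← Complex.exp_neg, ← Complex.exp_add, Real.log_div hx.ne' hm.ne']
  push_cast
  ring_nf

/-! ### `|L(w,χ)| ≤ 1 + 1/(Re w − 1)` on `Re w > 1` -/

/-- For `Re w > 1`: `‖L(w,χ)‖ ≤ ζ(Re w) ≤ Re w/(Re w − 1)`. [cite: MontgomeryVaughan2007, §1.3 Cor. 1.14] -/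
theorem norm_LFunction_le_div {D : ℕ} [NeZero D] (χ : DirichletCharacter ℂ D) {w : ℂ}
    (hw : 1 < w.re) : ‖χ.LFunction w‖ ≤ w.re / (w.re - 1) :=
  (KhaleL41.norm_LFunction_le_re_riemannZeta χ hw).trans
    ((Complex.re_le_norm _).trans (MontgomeryVaughan2001.norm_zeta_real_le hw))


/-! ### The objects in the variable `u = s − β_μ` -/

section Core

variable (c' : ℝ) {D : ℕ} [NeZero D] (χ : DirichletCharacter ℂ D)

/-- `Φ(u) = L(1−β_j+β_μ+u, χ)` is entire (`χ ≠ 1`). [cite: Zhang2022LandauSiegel, §8 Lemma 8.2 p.45] -/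
theorem differentiable_Phi (hχ : χ ≠ 1) (j μ : ℕ) :
    Differentiable ℂ fun u : ℂ => χ.LFunction (1 - betaJ c' D j + betaMu D μ + u) :=
  (DirichletCharacter.differentiable_LFunction hχ).comp
    ((differentiable_const _).add differentiable_id)

/-- `φ(u) = e^{u log x}Φ(u)` is entire. [cite: Zhang2022LandauSiegel, §8 Lemma 8.2 p.45] -/
theorem differentiable_phi (hχ : χ ≠ 1) (j μ : ℕ) (Lx : ℝ) :
    Differentiable ℂ fun u : ℂ =>
      cexp (u * (Lx : ℂ)) * χ.LFunction (1 - betaJ c' D j + betaMu D μ + u) :=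
  ((differentiable_id.mul (differentiable_const _)).cexp).mul (differentiable_Phi c' χ hχ j μ)

/-- **Perron + the pole-free shift to `Re u = α`** (the manuscript's `∫_{(1)}`, §8.u027, followed by
the part of the contour move that crosses no singularity): for `x ≥ 1`, `0 < α ≤ 2`, `χ ≠ 1`,
`Σ_{m<x} χ(m)m^{−(1−β_j)}(x/m)^{β_μ}log(x/m) = x^{β_μ}·(1/2π)∫ e^{(α+it)log x}Φ(α+it)(α+it)⁻² dt`
— the tree's `Zhang2022.Lemma84.sum_log_eq_integral_shift` at `κ = 2`, `σ₀ = α`, for the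
coefficients `f(m) = χ(m)m^{β_j−β_μ−1}`. [cite: Zhang2022LandauSiegel, §8 proof of Lemma 8.2 p.45] -/
theorem sum82_eq_line (hχ : χ ≠ 1) (j μ : ℕ) {x : ℝ} (hx : 1 ≤ x) (hα : 0 < alpha D)
    (hα2 : alpha D ≤ 2) :
    Typed.S8B.sum82 c' χ j μ x =
      (x : ℂ) ^ betaMu D μ * ((1 / (2 * π) : ℂ) * ∫ t : ℝ,
        cexp (((alpha D : ℂ) + t * I) * (Real.log x : ℂ)) *
          χ.LFunction (1 - betaJ c' D j + betaMu D μ + ((alpha D : ℂ) + t * I)) /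
          ((alpha D : ℂ) + t * I) ^ 2) := by
  have hx0 : 0 < x := by linarith
  have hreJ : (betaJ c' D j).re = 0 := Typed.S8B.betaJ_re c' D j
  have hreM : (betaMu D μ).re = 0 := Section8PerronSteps.betaMu_re D μ
  -- step 1: pull out `x^{β_μ}`
  have h1 : Typed.S8B.sum82 c' χ j μ x = (x : ℂ) ^ betaMu D μ *
      ∑ n ∈ Finset.Ioc 0 ⌊x⌋₊, (χ (n : ZMod D) * (n : ℂ) ^ (betaJ c' D j - betaMu D μ - 1)) *
        (Real.log (x / n) : ℂ) := by
    rw [Typed.S8B.sum82, Skeleton.sum82_eq χ (betaJ c' D j) (betaMu D μ) hx0, Finset.mul_sum]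
    refine Finset.sum_congr rfl fun m hm => ?_
    have hm0 : 0 < m := (Finset.mem_Ioc.1 hm).1
    have hm0' : (0 : ℝ) < m := by exact_mod_cast hm0
    have hmC : (m : ℂ) ≠ 0 := by exact_mod_cast hm0.ne'
    have hpow : (m : ℂ) ^ (betaJ c' D j - 1) * (m : ℂ) ^ (-betaMu D μ) =
        (m : ℂ) ^ (betaJ c' D j - betaMu D μ - 1) := by
      rw [← Complex.cpow_add _ _ hmC]; ring_nf
    rw [div_cpow_eq hx0 hm0' (betaMu D μ), Complex.ofReal_natCast, ← hpow]
    ring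
  -- step 2: Perron at `κ = 2` and the shift to `σ₀ = α`
  have hsum : LSeriesSummable
      (fun m : ℕ => χ (m : ZMod D) * (m : ℂ) ^ (betaJ c' D j - betaMu D μ - 1)) 2 := by
    refine LSeriesSummable_of_bounded_of_one_lt_re (m := 1) (fun n hn => ?_) (by norm_num)
    have hn0 : 0 < n := Nat.pos_of_ne_zero hn
    rw [norm_mul, Complex.norm_natCast_cpow_of_pos hn0]
    simp only [Complex.sub_re, Complex.one_re, hreJ, hreM]
    have h1 : ‖χ (n : ZMod D)‖ ≤ 1 := DirichletCharacter.norm_le_one χ _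
    have h2 : (n : ℝ) ^ ((0 : ℝ) - 0 - 1) ≤ 1 := by
      rw [show ((0 : ℝ) - 0 - 1) = -1 by norm_num, Real.rpow_neg_one]
      exact inv_le_one_of_one_le₀ (by exact_mod_cast hn0)
    calc ‖χ (n : ZMod D)‖ * (n : ℝ) ^ ((0 : ℝ) - 0 - 1) ≤ 1 * 1 :=
          mul_le_mul h1 h2 (by positivity) zero_le_one
      _ = 1 := one_mul _
  have hΦd : DifferentiableOn ℂ
      (fun u : ℂ => χ.LFunction (1 - betaJ c' D j + betaMu D μ + u))
      (re ⁻¹' Icc (alpha D) 2) := (differentiable_Phi c' χ hχ j μ).differentiableOn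
  have hΦeq : ∀ t : ℝ,
      LSeries (fun m : ℕ => χ (m : ZMod D) * (m : ℂ) ^ (betaJ c' D j - betaMu D μ - 1))
        (((2 : ℝ) : ℂ) + t * I) =
      χ.LFunction (1 - betaJ c' D j + betaMu D μ + (((2 : ℝ) : ℂ) + t * I)) := by
    intro t
    have hre : 1 < (1 - betaJ c' D j + betaMu D μ + (((2 : ℝ) : ℂ) + t * I)).re := by
      simp [hreJ, hreM]
    rw [DirichletCharacter.LFunction_eq_LSeries χ hre, LSeries, LSeries]
    refine tsum_congr fun n => ?_
    rcases eq_or_ne n 0 with rfl | hn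
    · simp [LSeries.term_zero]
    have hnC : (n : ℂ) ≠ 0 := by exact_mod_cast hn
    rw [LSeries.term_of_ne_zero hn, LSeries.term_of_ne_zero hn, div_eq_mul_inv, div_eq_mul_inv,
      ← Complex.cpow_neg, ← Complex.cpow_neg, mul_assoc, ← Complex.cpow_add _ _ hnC]
    congr 2
    ring
  have hM : ∀ u : ℂ, alpha D ≤ u.re → u.re ≤ 2 →
      ‖χ.LFunction (1 - betaJ c' D j + betaMu D μ + u)‖ ≤ 1 + 1 / alpha D := by
    intro u hu1 _
    have hure : 0 < u.re := lt_of_lt_of_le hα hu1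
    have hre : (1 - betaJ c' D j + betaMu D μ + u).re = 1 + u.re := by simp [hreJ, hreM]
    have h := norm_LFunction_le_div χ (w := 1 - betaJ c' D j + betaMu D μ + u) (by rw [hre]; linarith)
    rw [hre] at h
    calc ‖χ.LFunction (1 - betaJ c' D j + betaMu D μ + u)‖ ≤ (1 + u.re) / (1 + u.re - 1) := h
      _ = 1 + 1 / u.re := by
          rw [show (1 + u.re - 1) = u.re by ring, add_div, div_self hure.ne', add_comm]
      _ ≤ 1 + 1 / alpha D := by
          gcongr
  have key := Lemma84.sum_log_eq_integral_shift (f := fun m : ℕ =>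
      χ (m : ZMod D) * (m : ℂ) ^ (betaJ c' D j - betaMu D μ - 1)) hx hα hα2 hsum hΦd hΦeq hM
  rw [h1, key]

/-- **The residue at the double pole** (the rectangle side): for `a < 0 < b`, `0 < T′`,
`∮_{∂([a,b]×[−T′,T′])} e^{uL}Φ(u)u⁻² du = 2πi·φ′(0)`, `φ(u) = e^{uL}Φ(u)` — the tree's residue
theorem for poles of finite order. [cite: Zhang2022LandauSiegel, §8 proof of Lemma 8.2 p.45] -/
theorem rect_eq_deriv (hχ : χ ≠ 1) (j μ : ℕ) (Lx : ℝ) {a b T' : ℝ} (ha : a < 0) (hb : 0 < b)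
    (hT' : 0 < T') :
    rectBoundaryIntegral (fun u : ℂ =>
        cexp (u * (Lx : ℂ)) * χ.LFunction (1 - betaJ c' D j + betaMu D μ + u) / u ^ 2) a b (-T') T' =
      2 * π * I * deriv (fun u : ℂ =>
        cexp (u * (Lx : ℂ)) * χ.LFunction (1 - betaJ c' D j + betaMu D μ + u)) 0 := by
  have hφ := differentiable_phi c' χ hχ j μ Lx
  have h := rectBoundaryIntegral_eq_sum_of_poles_iteratedDeriv (ha.trans hb) (by linarith : -T' < T')
    ({0} : Finset ℂ)
    (fun u : ℂ => cexp (u * (Lx : ℂ)) * χ.LFunction (1 - betaJ c' D j + betaMu D μ + u) / u ^ 2)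
    (fun _ => 1)
    (fun _ u => cexp (u * (Lx : ℂ)) * χ.LFunction (1 - betaJ c' D j + betaMu D μ + u))
    Set.univ isOpen_univ (Set.subset_univ _) ?_ ?_ ?_
  · rw [h, Finset.sum_singleton, iteratedDeriv_one, Nat.factorial_one, Nat.cast_one, div_one]
  · intro p hp
    rw [Finset.coe_singleton, Set.mem_singleton_iff] at hp
    subst hp
    rw [Complex.mem_reProdIm, Complex.zero_re, Complex.zero_im]
    exact ⟨⟨ha, hb⟩, ⟨by linarith, hT'⟩⟩
  · rw [Finset.coe_singleton]
    refine (hφ.differentiableOn.div (differentiableOn_id.pow 2) fun u hu => ?_)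
    exact pow_ne_zero 2 (by simpa using hu.2)
  · intro p hp
    rw [Finset.mem_singleton] at hp
    subst hp
    refine ⟨Set.univ, Filter.univ_mem, hφ.differentiableOn, fun z _ _ => ?_⟩
    rw [sub_zero]

/-- **The circle side** (Cauchy's formula for the derivative): for `x > 0` and `|β_μ| < R`,
`(1/2πi)∮_{|s|=R} L(1−β_j+s,χ)x^s(s−β_μ)⁻² ds = x^{β_μ}·φ′(0)`, `φ(u) = e^{u log x}Φ(u)`.
[cite: Zhang2022LandauSiegel, §8 proof of Lemma 8.2 p.45] -/
theorem circInt_eq_deriv (hχ : χ ≠ 1) (j μ : ℕ) {x : ℝ} (hx : 0 < x) {R : ℝ}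
    (hR : ‖betaMu D μ‖ < R) :
    Typed.S8B.circInt R (fun s : ℂ =>
        χ.LFunction (1 - betaJ c' D j + s) * (x : ℂ) ^ s / (s - betaMu D μ) ^ 2) =
      (x : ℂ) ^ betaMu D μ * deriv (fun u : ℂ =>
        cexp (u * (Real.log x : ℂ)) * χ.LFunction (1 - betaJ c' D j + betaMu D μ + u)) 0 := by
  have hφ := differentiable_phi c' χ hχ j μ (Real.log x)
  have hxC : (x : ℂ) ≠ 0 := by exact_mod_cast hx.ne'
  -- `g(s) = L(1−β_j+s)x^s = x^{β_μ} φ(s − β_μ)`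
  have hg : (fun s : ℂ => χ.LFunction (1 - betaJ c' D j + s) * (x : ℂ) ^ s) =
      fun s => (x : ℂ) ^ betaMu D μ * (cexp ((s - betaMu D μ) * (Real.log x : ℂ)) *
        χ.LFunction (1 - betaJ c' D j + betaMu D μ + (s - betaMu D μ))) := by
    funext s
    have h1 : (x : ℂ) ^ s = (x : ℂ) ^ betaMu D μ * cexp ((s - betaMu D μ) * (Real.log x : ℂ)) := by
      rw [← cpow_eq_exp hx, ← Complex.cpow_add _ _ hxC]; ring_nf
    rw [h1]; ring_nf
  have hgd : Differentiable ℂ fun s : ℂ => χ.LFunction (1 - betaJ c' D j + s) * (x : ℂ) ^ s := by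
    rw [hg]
    exact (differentiable_const _).mul (hφ.comp (differentiable_id.sub (differentiable_const _)))
  have hmem : betaMu D μ ∈ Metric.ball (0 : ℂ) R := by
    rw [Metric.mem_ball, dist_zero_right]; exact hR
  have key := Complex.two_pi_I_inv_smul_circleIntegral_sub_sq_inv_smul_of_differentiable
    isOpen_univ (Set.subset_univ _) hgd.differentiableOn hmem
  have hfun : (fun s : ℂ => χ.LFunction (1 - betaJ c' D j + s) * (x : ℂ) ^ s / (s - betaMu D μ) ^ 2) =
      fun s => ((s - betaMu D μ) ^ 2)⁻¹ • (χ.LFunction (1 - betaJ c' D j + s) * (x : ℂ) ^ s) := by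
    funext s; rw [smul_eq_mul, div_eq_inv_mul]
  rw [Typed.S8B.circInt, hfun, ← smul_eq_mul, key, hg, deriv_const_mul _ ?_]
  · congr 1
    rw [show (0 : ℂ) = betaMu D μ - betaMu D μ from (sub_self _).symm]
    exact (deriv_comp_sub_const (f := fun u : ℂ =>
      cexp (u * (Real.log x : ℂ)) * χ.LFunction (1 - betaJ c' D j + betaMu D μ + u))
      (a := betaMu D μ) (x := betaMu D μ))
  · exact (hφ.comp (differentiable_id.sub (differentiable_const _))).differentiableAt

end Core


/-! ### Bounds for `Φ` on the contour -/

section Bounds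

variable (c' : ℝ) {D : ℕ} [NeZero D] (χ : DirichletCharacter ℂ D)

/-- **Crude bound on the left side and on the horizontal sides**: for `χ ≠ 1`, `Re u ≥ −1/2`,
`‖β_j‖ + ‖β_μ‖ ≤ 1`: `‖Φ(u)‖ = ‖L(1−β_j+β_μ+u,χ)‖ ≤ D·(|1 + Re u| + |Im u| + 1)·ζ(5/4)-const`
(`DirichletZFR.norm_LFunction_le_of_re_ge`, MV Lemma 10.15). [cite: MontgomeryVaughan2007, §10.2 Lemma 10.15] -/
theorem norm_Phi_le_crude (hχ : χ ≠ 1) (j μ : ℕ) (hβ : ‖betaJ c' D j‖ + ‖betaMu D μ‖ ≤ 1)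
    {u : ℂ} (hu : -(1 / 2 : ℝ) ≤ u.re) :
    ‖χ.LFunction (1 - betaJ c' D j + betaMu D μ + u)‖ ≤
      D * (|1 + u.re| + |u.im| + 1) * ∑' n : ℕ, ((n + 1 : ℕ) : ℝ) ^ (-(5 / 4 : ℝ)) := by
  have hreJ : (betaJ c' D j).re = 0 := Typed.S8B.betaJ_re c' D j
  have hreM : (betaMu D μ).re = 0 := Section8PerronSteps.betaMu_re D μ
  set w := 1 - betaJ c' D j + betaMu D μ + u with hw
  have hre : w.re = 1 + u.re := by simp [hw, hreJ, hreM]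
  have hre4 : 1 / 4 ≤ w.re := by rw [hre]; linarith
  have h := DirichletZFR.norm_LFunction_le_of_re_ge χ hχ hre4
  have hZ : 0 ≤ ∑' n : ℕ, ((n + 1 : ℕ) : ℝ) ^ (-(5 / 4 : ℝ)) := tsum_nonneg fun n => by positivity
  have hwn : ‖w‖ ≤ |1 + u.re| + |u.im| + 1 := by
    have h1 := Complex.norm_le_abs_re_add_abs_im w
    have him : w.im = u.im + ((betaMu D μ).im - (betaJ c' D j).im) := by
      simp [hw]; ring
    have h2 : |w.im| ≤ |u.im| + (‖betaMu D μ‖ + ‖betaJ c' D j‖) := by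
      rw [him]
      refine (abs_add_le _ _).trans (add_le_add le_rfl ((abs_sub _ _).trans (add_le_add ?_ ?_)))
      · exact Complex.abs_im_le_norm _
      · exact Complex.abs_im_le_norm _
    rw [hre] at h1
    linarith
  calc ‖χ.LFunction w‖ ≤ D * ‖w‖ * ∑' n : ℕ, ((n + 1 : ℕ) : ℝ) ^ (-(5 / 4 : ℝ)) := h
    _ ≤ D * (|1 + u.re| + |u.im| + 1) * ∑' n : ℕ, ((n + 1 : ℕ) : ℝ) ^ (-(5 / 4 : ℝ)) := by
        gcongr

/-- **On `Re u ≥ α`**: `‖Φ(u)‖ ≤ 1 + 1/α` (`|L(w,χ)| ≤ ζ(Re w) ≤ Re w/(Re w − 1)`, `Re w = 1 + Re u`).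
[cite: MontgomeryVaughan2007, §1.3 Cor. 1.14] -/
theorem norm_Phi_le_right (j μ : ℕ) {α : ℝ} (hα : 0 < α) {u : ℂ} (hu : α ≤ u.re) :
    ‖χ.LFunction (1 - betaJ c' D j + betaMu D μ + u)‖ ≤ 1 + 1 / α := by
  have hreJ : (betaJ c' D j).re = 0 := Typed.S8B.betaJ_re c' D j
  have hreM : (betaMu D μ).re = 0 := Section8PerronSteps.betaMu_re D μ
  have hure : 0 < u.re := lt_of_lt_of_le hα hu
  have hre : (1 - betaJ c' D j + betaMu D μ + u).re = 1 + u.re := by simp [hreJ, hreM]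
  have h := norm_LFunction_le_div χ (w := 1 - betaJ c' D j + betaMu D μ + u) (by rw [hre]; linarith)
  rw [hre] at h
  calc ‖χ.LFunction (1 - betaJ c' D j + betaMu D μ + u)‖ ≤ (1 + u.re) / (1 + u.re - 1) := h
    _ = 1 + 1 / u.re := by
        rw [show (1 + u.re - 1) = u.re by ring, add_div, div_self hure.ne', add_comm]
    _ ≤ 1 + 1 / α := by gcongr

end Bounds

/-! ### The node -/

/-- `ℓ^{1/10} ≥ 10` once `ℓ ≥ 10¹⁰`, hence `ℓ^{1.1} = ℓ·ℓ^{1/10} ≥ 10ℓ`. [folklore] -/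
private theorem ten_mul_le_rpow {ℓ : ℝ} (hℓ : (10 : ℝ) ^ (10 : ℕ) ≤ ℓ) : 10 * ℓ ≤ ℓ ^ (1.1 : ℝ) := by
  have hℓ0 : 0 < ℓ := lt_of_lt_of_le (by positivity) hℓ
  have h1 : (10 : ℝ) ≤ ℓ ^ (1 / 10 : ℝ) := by
    have : ((10 : ℝ) ^ (10 : ℕ)) ^ (1 / 10 : ℝ) = 10 := by
      rw [← Real.rpow_natCast, ← Real.rpow_mul (by norm_num)]; norm_num
    calc (10 : ℝ) = ((10 : ℝ) ^ (10 : ℕ)) ^ (1 / 10 : ℝ) := this.symm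
      _ ≤ ℓ ^ (1 / 10 : ℝ) :=
          Real.rpow_le_rpow (by norm_num : (0:ℝ) ≤ (10:ℝ) ^ (10:ℕ)) hℓ (by norm_num)
  have h2 : ℓ ^ (1.1 : ℝ) = ℓ * ℓ ^ (1 / 10 : ℝ) := by
    rw [show (1.1 : ℝ) = 1 + 1 / 10 by norm_num, Real.rpow_add hℓ0, Real.rpow_one]
  rw [h2]
  nlinarith

/-- `ℓ⁹ ≤ 9!·e^{2ℓ}` for `ℓ ≥ 0`. [folklore] -/
private theorem pow_nine_le {ℓ : ℝ} (hℓ : 0 ≤ ℓ) : ℓ ^ 9 ≤ (Nat.factorial 9 : ℝ) * Real.exp (2 * ℓ) := by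
  have h := Real.pow_div_factorial_le_exp (x := 2 * ℓ) (by linarith) 9
  have hf : (0 : ℝ) < Nat.factorial 9 := by positivity
  rw [div_le_iff₀ hf, mul_pow] at h
  nlinarith [Real.exp_pos (2 * ℓ), pow_nonneg hℓ 9]

/-- **`Z22:§8.u030`, first equality, DISCHARGED** (`Typed.S8B.Sum82ViaCircle c′`, `c = 1`): for all
large `D`, `χ` real primitive, `1 ≤ j ≤ 3`, `μ ∈ {6,7}`, `T < x < P`,
`‖Σ_{m<x} χ(m)m^{−(1−β_j)}(x/m)^{β_μ}log(x/m) − (1/2πi)∮_{|s|=5α} L(1−β_j+s,χ)x^s(s−β_μ)⁻² ds‖ ≤ C·exp(−𝓛^{1/10})`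
— Perron + shift to `Re u = α`, the rectangle `[−1/2, α] × [−D³, D³]` with its double pole at
`u = 0` (residue `= x^{−β_μ}×` the circle term), and the three boundary pieces, each `≪ e^{−𝓛}`.
[cite: Zhang2022LandauSiegel, §8 proof of Lemma 8.2 p.45, tex L2349–L2366] -/
theorem sum82ViaCircle_holds (c' : ℝ) : Typed.S8B.Sum82ViaCircle c' := by
  set Zc : ℝ := ∑' n : ℕ, ((n + 1 : ℕ) : ℝ) ^ (-(5 / 4 : ℝ)) with hZcdef
  have hZc : 0 ≤ Zc := tsum_nonneg fun n => by positivity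
  -- the constant
  set K : ℝ := 1 / (2 * π) * (2 * Real.exp π * Nat.factorial 9 + 6 * π * Zc + 12 * Real.exp π * Zc)
    with hKdef
  have hK : 0 ≤ K := by positivity
  set M : ℝ := max ((10 : ℝ) ^ (10 : ℕ)) (30 * π * |c'| + 3) with hMdef
  refine ⟨1, one_pos, K, ⌈Real.exp M⌉₊, fun D _ χ hD _ hp _ j _ μ _ x hTx hxP => ?_⟩
  -- parameters
  have hℓM : M ≤ ell D := Section8Lemma82Steps.le_ell hD
  have hℓ10 : (10 : ℝ) ^ (10 : ℕ) ≤ ell D := le_trans (le_max_left _ _) hℓM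
  have hℓc : 30 * π * |c'| + 3 ≤ ell D := le_trans (le_max_right _ _) hℓM
  have hℓ3 : 3 ≤ ell D := by nlinarith [Real.pi_pos, abs_nonneg c']
  have hℓ1 : 1 ≤ ell D := by linarith
  have hℓ0 : 0 < ell D := by linarith
  have hD3 : 3 ≤ D := Section8Lemma82Steps.three_le_of_ell hℓ3
  have hχ : χ ≠ 1 := ne_one_of_isPrimitive_of_three_le hp hD3
  have hαeq : alpha D = π / ell D ^ 9 := Section2.alpha_eq_pi_div_ell9 D
  have hα : 0 < alpha D := by rw [hαeq]; positivity
  have hℓ9 : π ≤ ell D ^ 9 := by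
    have : (4 : ℝ) ≤ ell D ^ 9 := le_trans (by norm_num) (pow_le_pow_left₀ (by norm_num) hℓ3 9)
    linarith [Real.pi_lt_four]
  have hα1 : alpha D ≤ 1 := by rw [hαeq, div_le_one (by positivity)]; exact hℓ9
  have hα2 : alpha D ≤ 2 := by linarith
  -- `x`, `log x`
  have hT1 : 1 ≤ bigT D := Real.one_le_exp (by positivity)
  have hx1 : 1 ≤ x := le_trans hT1 hTx.le
  have hx0 : 0 < x := by linarith
  set Lx : ℝ := Real.log x with hLxdef
  have hLxT : ell D ^ (1.1 : ℝ) < Lx := by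
    have := Real.log_lt_log (Real.exp_pos _) hTx
    rwa [Real.log_exp] at this
  have hLxP : Lx < ell D ^ 9 := by
    have := Real.log_lt_log hx0 hxP
    rwa [bigP, Real.log_exp] at this
  have hLx0 : 0 ≤ Lx := Real.log_nonneg hx1
  have hαLx : Real.exp (alpha D * Lx) ≤ Real.exp π := by
    apply Real.exp_le_exp.2
    rw [hαeq]
    calc π / ell D ^ 9 * Lx ≤ π / ell D ^ 9 * ell D ^ 9 :=
          mul_le_mul_of_nonneg_left hLxP.le (by positivity)
      _ = π := by field_simp
  -- the shifts
  have hsmall := Section8Lemma82Steps.small_shift_of_ell_ge (c' := c') hℓc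
  have hβJ : ‖betaJ c' D j‖ ≤ 7 / 2 * alpha D :=
    Section8Lemma82Steps.norm_betaJ_le j hα.le hℓ0.le hsmall
  have hβM : ‖betaMu D μ‖ ≤ 5 / 2 * alpha D := Section8Lemma82Steps.norm_betaMu_le μ hα.le
  have hα6 : 6 * alpha D ≤ 1 := by
    rw [hαeq]
    have h6 : 6 * π ≤ ell D ^ 9 := by
      have : (27 : ℝ) ≤ ell D ^ 9 := le_trans (by norm_num) (pow_le_pow_left₀ (by norm_num) hℓ3 9)
      nlinarith [Real.pi_lt_four]
    rw [show 6 * (π / ell D ^ 9) = 6 * π / ell D ^ 9 by ring, div_le_one (by positivity)]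
    exact h6
  have hβ : ‖betaJ c' D j‖ + ‖betaMu D μ‖ ≤ 1 := by linarith
  have hβR : ‖betaMu D μ‖ < 5 * alpha D := by linarith
  -- heights
  set Th : ℝ := (D : ℝ) ^ 3 with hThdef
  have hD1 : (1 : ℝ) ≤ D := by exact_mod_cast le_trans (by norm_num) hD3
  have hD0 : (0 : ℝ) < D := by linarith
  have hTh1 : 1 ≤ Th := one_le_pow₀ hD1
  have hTh0 : 0 < Th := by linarith
  -- the functions
  set Φ : ℂ → ℂ := fun u => χ.LFunction (1 - betaJ c' D j + betaMu D μ + u) with hΦdef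
  set φ : ℂ → ℂ := fun u => cexp (u * (Lx : ℂ)) * Φ u with hφdef
  set G : ℂ → ℂ := fun u => cexp (u * (Lx : ℂ)) * Φ u / u ^ 2 with hGdef
  have hΦd : Differentiable ℂ Φ := differentiable_Phi c' χ hχ j μ
  -- (1) Perron + shift
  have h1 : Typed.S8B.sum82 c' χ j μ x =
      (x : ℂ) ^ betaMu D μ * ((1 / (2 * π) : ℂ) * ∫ t : ℝ, G ((alpha D : ℂ) + t * I)) :=
    sum82_eq_line c' χ hχ j μ hx1 hα hα2
  -- (2) decomposition of the line `Re u = α`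
  have hΦright : ∀ t : ℝ, ‖Φ ((alpha D : ℂ) + t * I)‖ ≤ 1 + 1 / alpha D := fun t =>
    norm_Phi_le_right c' χ j μ hα (by simp)
  have hint : Integrable fun t : ℝ => G ((alpha D : ℂ) + t * I) :=
    Lemma84.integrable_line (Φ := Φ) (L := Lx) hα (hΦd.continuous.comp (by fun_prop)) hΦright
  have h2 := Lemma84.integral_line_decomp (Θ := G) (σ₀ := alpha D) (σ₁ := 1 / 2) (T := Th) hint
  -- (3) the residue, rectangle and circle
  have h3 : rectBoundaryIntegral G (-(1 / 2)) (alpha D) (-Th) Th = 2 * π * I * deriv φ 0 :=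
    rect_eq_deriv c' χ hχ j μ Lx (by norm_num) hα hTh0
  have h4 : Typed.S8B.circInt (5 * alpha D) (fun s : ℂ =>
      χ.LFunction (1 - betaJ c' D j + s) * (x : ℂ) ^ s / (s - betaMu D μ) ^ 2) =
      (x : ℂ) ^ betaMu D μ * deriv φ 0 :=
    circInt_eq_deriv c' χ hχ j μ hx0 hβR
  -- (4) the pieces
  have htails := Lemma84.norm_tails_le (Φ := Φ) (L := Lx) hα hTh1 (by positivity : (0:ℝ) ≤ 1 + 1 / alpha D)
    (fun t _ => hΦright t)
  have hleftM : ∀ t : ℝ, |t| ≤ Th → ‖Φ (((-(1 / 2) : ℝ) : ℂ) + t * I)‖ ≤ D * (Th + 2) * Zc := by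
    intro t ht
    have h := norm_Phi_le_crude c' χ hχ j μ hβ (u := ((-(1 / 2) : ℝ) : ℂ) + t * I) (by simp)
    refine h.trans ?_
    have hre : (((-(1 / 2) : ℝ) : ℂ) + t * I).re = -(1 / 2) := by simp
    have him : (((-(1 / 2) : ℝ) : ℂ) + t * I).im = t := by simp
    rw [hre, him, show |1 + -(1 / 2 : ℝ)| = 1 / 2 by norm_num]
    have : (1 / 2 : ℝ) + |t| + 1 ≤ Th + 2 := by linarith only [ht]
    gcongr
  have hleft := Lemma84.norm_left_le (Φ := Φ) (L := Lx) (σ₁ := 1 / 2) (T := Th) (by norm_num)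
    hTh0.le (by positivity : (0:ℝ) ≤ D * (Th + 2) * Zc) hleftM
  have hB : ∀ T' : ℝ, |T'| = Th → ∀ u : ℝ, -(1 / 2) ≤ u → u ≤ alpha D →
      ‖G ((u : ℂ) + (T' : ℂ) * I)‖ ≤ Real.exp π * (D * (Th + 3) * Zc) / Th ^ 2 := by
    intro T' hT' u hu1 hu2
    have hΦu := norm_Phi_le_crude c' χ hχ j μ hβ (u := (u : ℂ) + (T' : ℂ) * I)
      (by simp only [Complex.add_re, Complex.ofReal_re, Complex.mul_re, Complex.I_re,
        Complex.ofReal_im, Complex.I_im]; linarith only [hu1])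
    have hre : ((u : ℂ) + (T' : ℂ) * I).re = u := by simp
    have him : ((u : ℂ) + (T' : ℂ) * I).im = T' := by simp
    rw [hre, him, hT'] at hΦu
    have hΦu' : ‖Φ ((u : ℂ) + (T' : ℂ) * I)‖ ≤ D * (Th + 3) * Zc := by
      refine hΦu.trans ?_
      have h1u : 0 ≤ 1 + u := by linarith only [hu1]
      have : |1 + u| + Th + 1 ≤ Th + 3 := by
        rw [abs_of_nonneg h1u]; linarith only [hu2, hα1]
      gcongr
    have hexp : ‖cexp (((u : ℂ) + (T' : ℂ) * I) * (Lx : ℂ))‖ ≤ Real.exp π := by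
      rw [Complex.norm_exp]
      have : (((u : ℂ) + (T' : ℂ) * I) * (Lx : ℂ)).re = u * Lx := by simp
      rw [this]
      exact le_trans (Real.exp_le_exp.2 (mul_le_mul_of_nonneg_right hu2 hLx0)) hαLx
    have hz : Th ≤ ‖(u : ℂ) + (T' : ℂ) * I‖ := by
      have h := Complex.abs_im_le_norm ((u : ℂ) + (T' : ℂ) * I)
      rwa [him, hT'] at h
    have hden : Th ^ 2 ≤ ‖((u : ℂ) + (T' : ℂ) * I) ^ 2‖ := by
      rw [norm_pow]; exact pow_le_pow_left₀ hTh0.le hz 2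
    have hden0 : 0 < ‖((u : ℂ) + (T' : ℂ) * I) ^ 2‖ := lt_of_lt_of_le (pow_pos hTh0 2) hden
    have hG : G ((u : ℂ) + (T' : ℂ) * I) =
        cexp (((u : ℂ) + (T' : ℂ) * I) * (Lx : ℂ)) * Φ ((u : ℂ) + (T' : ℂ) * I) /
          ((u : ℂ) + (T' : ℂ) * I) ^ 2 := rfl
    have hnum0 : 0 ≤ Real.exp π * (D * (Th + 3) * Zc) :=
      mul_nonneg (Real.exp_pos _).le (mul_nonneg (mul_nonneg hD0.le
        (add_nonneg hTh0.le (by norm_num))) hZc)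
    rw [hG, norm_div, norm_mul, div_le_div_iff₀ hden0 (pow_pos hTh0 2)]
    calc ‖cexp (((u : ℂ) + (T' : ℂ) * I) * (Lx : ℂ))‖ * ‖Φ ((u : ℂ) + (T' : ℂ) * I)‖ * Th ^ 2
        ≤ Real.exp π * (D * (Th + 3) * Zc) * Th ^ 2 :=
          mul_le_mul_of_nonneg_right (mul_le_mul hexp hΦu' (norm_nonneg _) (Real.exp_pos _).le)
            (pow_nonneg hTh0.le 2)
      _ ≤ Real.exp π * (D * (Th + 3) * Zc) * ‖((u : ℂ) + (T' : ℂ) * I) ^ 2‖ :=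
          mul_le_mul_of_nonneg_left hden hnum0
  have hσ : -(1 / 2 : ℝ) ≤ alpha D := by linarith only [hα]
  have htop := Lemma84.norm_horizontal_le (Θ := G) (σ₀ := alpha D) (σ₁ := 1 / 2) (T' := Th)
    hσ (hB Th (abs_of_pos hTh0))
  have hbot := Lemma84.norm_horizontal_le (Θ := G) (σ₀ := alpha D) (σ₁ := 1 / 2) (T' := -Th)
    hσ (hB (-Th) (by rw [abs_neg, abs_of_pos hTh0]))
  -- (5) assembly of the identity
  have hxβ : ‖(x : ℂ) ^ betaMu D μ‖ = 1 := norm_cpow_of_re_eq_zero hx0 (Section8PerronSteps.betaMu_re D μ)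
  have hdiff : Typed.S8B.sum82 c' χ j μ x - Typed.S8B.circInt (5 * alpha D) (fun s : ℂ =>
        χ.LFunction (1 - betaJ c' D j + s) * (x : ℂ) ^ s / (s - betaMu D μ) ^ 2) =
      (x : ℂ) ^ betaMu D μ * (1 / (2 * π) : ℂ) *
        ((∫ t in Iic (-Th), G ((alpha D : ℂ) + t * I)) + (∫ t in Ioi Th, G ((alpha D : ℂ) + t * I)) +
          (∫ t in (-Th)..Th, G (((-(1 / 2) : ℝ) : ℂ) + t * I)) +
          I * (∫ u in (-(1 / 2))..alpha D, G (u + ((-Th : ℝ) : ℂ) * I)) -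
          I * (∫ u in (-(1 / 2))..alpha D, G (u + (Th : ℂ) * I))) := by
    rw [h1, h4, h2, h3]
    have hπ : (π : ℂ) ≠ 0 := by exact_mod_cast Real.pi_ne_zero
    field_simp
    ring_nf
    rw [Complex.I_sq]
    ring
  -- (6) the numeric bounds
  have hDexp : (D : ℝ) = Real.exp (ell D) := by rw [ell, Real.exp_log hD0]
  have e1 : 2 * (Real.exp (alpha D * Lx) * (1 + 1 / alpha D) / Th) ≤
      2 * Real.exp π * Nat.factorial 9 * Real.exp (-ell D) := by
    have hM1 : 1 + 1 / alpha D ≤ ell D ^ 9 := by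
      rw [hαeq, one_div_div]
      have : ell D ^ 9 / π ≤ ell D ^ 9 / 3 := by
        apply div_le_div_of_nonneg_left (by positivity) (by norm_num)
        linarith only [Real.pi_gt_three]
      have h27 : (27 : ℝ) ≤ ell D ^ 9 := le_trans (by norm_num) (pow_le_pow_left₀ (by norm_num) hℓ3 9)
      linarith only [this, h27]
    have h9 := pow_nine_le hℓ0.le
    have hTh : Th = Real.exp (3 * ell D) := by rw [hThdef, hDexp, ← Real.exp_nat_mul]; norm_num
    rw [hTh]
    have hexp3 : Real.exp (3 * ell D) = Real.exp (2 * ell D) * Real.exp (ell D) := by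
      rw [← Real.exp_add]; ring_nf
    calc 2 * (Real.exp (alpha D * Lx) * (1 + 1 / alpha D) / Real.exp (3 * ell D))
        ≤ 2 * (Real.exp π * ((Nat.factorial 9 : ℝ) * Real.exp (2 * ell D)) / Real.exp (3 * ell D)) := by
          gcongr
          exact hM1.trans h9
      _ = 2 * Real.exp π * Nat.factorial 9 * Real.exp (-ell D) := by
          rw [hexp3, Real.exp_neg]; field_simp
  have e2 : Real.exp (-(1 / 2) * Lx) * (D * (Th + 2) * Zc) * (π / (1 / 2)) ≤
      6 * π * Zc * Real.exp (-ell D) := by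
    have hTh2 : (D : ℝ) * (Th + 2) ≤ 3 * Real.exp (4 * ell D) := by
      have : Th + 2 ≤ 3 * Th := by linarith only [hTh1]
      calc (D : ℝ) * (Th + 2) ≤ D * (3 * Th) := by gcongr
        _ = 3 * (Real.exp (ell D) * Real.exp (3 * ell D)) := by
            rw [hThdef, hDexp, ← Real.exp_nat_mul]; push_cast; ring
        _ = 3 * Real.exp (4 * ell D) := by rw [← Real.exp_add]; ring_nf
    have hLx11 : 10 * ell D ≤ Lx := le_trans (ten_mul_le_rpow hℓ10) hLxT.le
    have hexp : Real.exp (-(1 / 2) * Lx) * Real.exp (4 * ell D) ≤ Real.exp (-ell D) := by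
      rw [← Real.exp_add]; exact Real.exp_le_exp.2 (by linarith only [hLx11])
    calc Real.exp (-(1 / 2) * Lx) * (D * (Th + 2) * Zc) * (π / (1 / 2))
        = 2 * π * Zc * (Real.exp (-(1 / 2) * Lx) * (D * (Th + 2))) := by ring
      _ ≤ 2 * π * Zc * (Real.exp (-(1 / 2) * Lx) * (3 * Real.exp (4 * ell D))) := by gcongr
      _ = 6 * π * Zc * (Real.exp (-(1 / 2) * Lx) * Real.exp (4 * ell D)) := by ring
      _ ≤ 6 * π * Zc * Real.exp (-ell D) := by gcongr
  have e3 : 2 * ((alpha D + 1 / 2) * (Real.exp π * (D * (Th + 3) * Zc) / Th ^ 2)) ≤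
      12 * Real.exp π * Zc * Real.exp (-ell D) := by
    have hq : (D : ℝ) * (Th + 3) * Zc / Th ^ 2 ≤ 4 * Zc * Real.exp (-ell D) := by
      have h4 : Th + 3 ≤ 4 * Th := by linarith only [hTh1]
      have hD2 : (D : ℝ) ^ 2 = Real.exp (2 * ell D) := by rw [hDexp, ← Real.exp_nat_mul]; norm_num
      calc (D : ℝ) * (Th + 3) * Zc / Th ^ 2 ≤ D * (4 * Th) * Zc / Th ^ 2 := by gcongr
        _ = 4 * Zc / (D : ℝ) ^ 2 := by rw [hThdef]; field_simp
        _ = 4 * Zc * Real.exp (-(2 * ell D)) := by rw [Real.exp_neg, ← hD2]; ring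
        _ ≤ 4 * Zc * Real.exp (-ell D) :=
            mul_le_mul_of_nonneg_left (Real.exp_le_exp.2 (by linarith only [hℓ0]))
              (mul_nonneg (by norm_num) hZc)
    have hα32 : alpha D + 1 / 2 ≤ 3 / 2 := by linarith only [hα1]
    calc 2 * ((alpha D + 1 / 2) * (Real.exp π * (D * (Th + 3) * Zc) / Th ^ 2))
        = 2 * (alpha D + 1 / 2) * Real.exp π * (D * (Th + 3) * Zc / Th ^ 2) := by ring
      _ ≤ 2 * (3 / 2) * Real.exp π * (4 * Zc * Real.exp (-ell D)) := by gcongr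
      _ = 12 * Real.exp π * Zc * Real.exp (-ell D) := by ring
  -- (7) conclusion
  have hexp_le : Real.exp (-ell D) ≤ Real.exp (-(1 * ell D ^ (1 / 10 : ℝ))) := by
    apply Real.exp_le_exp.2
    have : ell D ^ (1 / 10 : ℝ) ≤ ell D ^ (1 : ℝ) :=
      Real.rpow_le_rpow_of_exponent_le hℓ1 (by norm_num)
    rw [Real.rpow_one] at this
    linarith only [this]
  rw [hdiff]
  have hn2π : ‖(1 / (2 * π) : ℂ)‖ = 1 / (2 * π) := by
    rw [show (1 / (2 * π) : ℂ) = ((1 / (2 * π) : ℝ) : ℂ) by push_cast; ring, Complex.norm_real,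
      Real.norm_of_nonneg (by positivity)]
  set A := ∫ t in Iic (-Th), G ((alpha D : ℂ) + t * I) with hAdef
  set B := ∫ t in Ioi Th, G ((alpha D : ℂ) + t * I) with hBdef
  set Cl := ∫ t in (-Th)..Th, G (((-(1 / 2) : ℝ) : ℂ) + t * I) with hCdef
  set E := ∫ u in (-(1 / 2))..alpha D, G (u + ((-Th : ℝ) : ℂ) * I) with hEdef
  set F := ∫ u in (-(1 / 2))..alpha D, G (u + (Th : ℂ) * I) with hFdef
  have hsum : ‖A + B + Cl + I * E - I * F‖ ≤ ‖A‖ + ‖B‖ + ‖Cl‖ + ‖E‖ + ‖F‖ := by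
    have hIE : ‖I * E‖ = ‖E‖ := by rw [norm_mul, Complex.norm_I, one_mul]
    have hIF : ‖I * F‖ = ‖F‖ := by rw [norm_mul, Complex.norm_I, one_mul]
    calc ‖A + B + Cl + I * E - I * F‖ ≤ ‖A + B + Cl + I * E‖ + ‖I * F‖ := norm_sub_le _ _
      _ ≤ ‖A + B + Cl‖ + ‖I * E‖ + ‖I * F‖ := by
          linarith only [norm_add_le (A + B + Cl) (I * E)]
      _ ≤ ‖A‖ + ‖B‖ + ‖Cl‖ + ‖I * E‖ + ‖I * F‖ := by
          linarith only [norm_add_le (A + B) Cl, norm_add_le A B]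
      _ = ‖A‖ + ‖B‖ + ‖Cl‖ + ‖E‖ + ‖F‖ := by rw [hIE, hIF]
  have htails' : ‖B‖ + ‖A‖ ≤ 2 * Real.exp π * Nat.factorial 9 * Real.exp (-ell D) :=
    htails.trans e1
  have hleft' : ‖Cl‖ ≤ 6 * π * Zc * Real.exp (-ell D) := hleft.trans e2
  have hhor' : ‖E‖ + ‖F‖ ≤ 12 * Real.exp π * Zc * Real.exp (-ell D) := by
    have : ‖E‖ + ‖F‖ ≤ 2 * ((alpha D + 1 / 2) * (Real.exp π * (D * (Th + 3) * Zc) / Th ^ 2)) := by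
      linarith only [hbot, htop]
    exact this.trans e3
  calc ‖(x : ℂ) ^ betaMu D μ * (1 / (2 * π) : ℂ) * (A + B + Cl + I * E - I * F)‖
      = 1 / (2 * π) * ‖A + B + Cl + I * E - I * F‖ := by
        rw [norm_mul, norm_mul, hxβ, hn2π, one_mul]
    _ ≤ 1 / (2 * π) * (‖A‖ + ‖B‖ + ‖Cl‖ + ‖E‖ + ‖F‖) :=
        mul_le_mul_of_nonneg_left hsum (by positivity)
    _ ≤ 1 / (2 * π) * ((2 * Real.exp π * Nat.factorial 9 + 6 * π * Zc + 12 * Real.exp π * Zc) *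
          Real.exp (-ell D)) := by
        apply mul_le_mul_of_nonneg_left _ (by positivity)
        nlinarith only [htails', hleft', hhor', Real.exp_pos (-ell D)]
    _ = K * Real.exp (-ell D) := by rw [hKdef]; ring
    _ ≤ K * Real.exp (-(1 * ell D ^ (1 / 10 : ℝ))) := mul_le_mul_of_nonneg_left hexp_le hK

variable (c' : ℝ) in
/-- `Sum82ViaCircle` — `_holds` alias of `sum82ViaCircle_holds` above under the fact's exact name, stated under the
prover's own binders as section variables (appended 2026-08-28, D-0026 bookkeeping: the proof term is the
existing theorem of this file; no statement, definition or attribute is edited; no new named fact; the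
ledger's debt table listed the fact unproved). [cite: Zhang2022LandauSiegel, §8 proof of Lemma 8.2 p.45, tex L2349–L2366] -/
theorem _root_.Literature.NumberTheory.LFunctions.Zhang2022.Typed.S8B.Sum82ViaCircle_holds :
    _root_.Literature.NumberTheory.LFunctions.Zhang2022.Typed.S8B.Sum82ViaCircle c' :=
  _root_.Literature.NumberTheory.LFunctions.Zhang2022.Section8Sum82ViaCircle.sum82ViaCircle_holds (c' := c')

end Literature.NumberTheory.LFunctions.Zhang2022.Section8Sum82ViaCircle
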